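import Summits.ABC.IUTFork.Conditional.AbcOfS
import Summits.ABC.IUTFork.Charitable.Thm311D4Derive
import HarnessLib

/-!
# Block D × branch C junction, team D4: the C certificate `abc_of_S_v2` with its [S] binder DISCHARGED by `Thm311Charitable_4`

Proof-only file (D-0012) of the abc-iut cell, block D (maximally-charitable re-typings of [IUTchIII] Thm. 3.11), team D4, seat
abc-iut-D4-prv (prover (a)); rung LADDER-ABC:A2.D (junction with A2.C). TAKES NO SIDE on [IUTchIII] Cor. 3.12. NO definition, NO
`Prop` fact. ONE theorem, purely compositional over two LANDED files: abc-iut-C-cert-1's branch-C certificate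
`Summit.ABC.IUTFork.Conditional.abc_of_S_v2` (Conditional/AbcOfS.lean: `ABC` from, per genuine Θ-volume datum, the single named
proposition S = `Cor312Vol.PilotKummerIndRelated` + the Corollary's two region pins + `BridgeHyps` + [IUTchIII] Thm. 3.11 (ii)(b) at the
setting's column + the campaign-S hull-volume node + the two READ equations) and this seat's block-D derivation
`Summit.ABC.IUTFork.Charitable.D4Derive.s_of_charitable_4_pinFree` (Charitable/Thm311D4Derive.lean, p433392: S from team D4's
maximally-charitable Theorem 3.11 `Thm311Charitable_4`, abc-iut-D4-typ p433089, with the pins' q-datum read as `Q.qΨ P.n m₁`).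
S. Mochizuki, *Inter-universal Teichmüller theory III/IV* (kurims, May 2020); [claim: Mochizuki2012, status: disputed].

WHAT THE THEOREM SAYS — and what it does NOT. `abc_of_charitable_4` is `abc_of_S_v2` with the hypothesis [S] REPLACED by [CHAR] =
«team D4's charitable Theorem 3.11 holds at every datum's typed lattice situation, for some link/Kummer data `Q`» and the C312 cone
binder `hKumB` ((ii)(b) at column `n`) ABSORBED (it is a conjunct of `Thm311Charitable_4`); every other binder of the C certificate is
carried VERBATIM ([PIN] two region pins at the q-datum `(Q P l T).qΨ (P312 P l T).n (m₁ P l T)` + `BridgeHyps`; [CONE] the hull-volume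
estimate `hvol` at the genuine data; [READ] `hΘ`, `hq`). Explicit `Prop` binders: CHAR 1 · PIN 2 · FACT 0 · CONE 1 · READ 2 = 6 (v2: 7,
with S 1 and CONE 2). So, IN KERNEL and ONLY in this conditional sense: «`ABC` follows from the maximally-charitable reading of
[IUTchIII] Thm. 3.11 (team D4) + the Corollary's pins + the bridge hypotheses + the campaign-S hull-volume node + the two reading
equations, as typed». This is NOT a proof of abc, NOT an endorsement of the charitable reading — whose decisive clause (L)
`D4.LinkKummerCompat` is FALSE at the pinned G-countermodel's data (`D4Derive.not_charitable_4_pinned`) and whose faithfulness to print is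
the D referees' open question (c) — and takes no side between authors; typed ≠ proved; locates / conditionally verifies; no abc claim.
-/

noncomputable section

namespace Summit.ABC.IUTFork.Charitable.D4Derive

open Thm311 Cor312 Cor312Vol Literature.IUT.LogThetaLattice

open Literature.IUT.LogVolume Literature.NumberTheory.DiophantineGeometry.GenEll Summit.ABC.ABC.Theorems in
/-- **`abc_of_charitable_4` — branch C's certificate `abc_of_S_v2` with [S] discharged by team D4's charitable Theorem 3.11.** Per
`λ`-line point `P`, prime `l` and genuine Θ-volume datum `T` (DATA: the typed lattice situation `F P l T`, abc-iut-D4-typ's link/Kummer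
data `Q P l T`, the Cor.-3.12 setting `P312 P l T`, the region reading `ρ P l T`, a lattice position `m₁ P l T`), the explicit hypotheses
are: [CHAR] `hChar` = `Thm311Charitable_4 (F P l T) (Q P l T)` at every datum · [PIN] `hPin` = the two region pins (pΘ)(pq′) for the
q-datum `(Q P l T).qΨ (P312 P l T).n (m₁ P l T)`, `hBridge` = `BridgeHyps` · [CONE] `hvol` = the hull-volume estimate at the genuine data
(campaign S) · [READ] `hΘ`, `hq`. Route: `D4Derive.s_of_charitable_4_pinFree` supplies [S] and `(hChar …).2.1` supplies (ii)(b) to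
`Conditional.abc_of_S_v2`, verbatim otherwise. CONDITIONAL; no side taken on [IUTchIII] Cor. 3.12; whether the consumed clause
`D4.LinkKummerCompat` is print's is the D referees' question. [claim: Mochizuki2012, status: disputed] -/
theorem abc_of_charitable_4
    -- DATA (uncounted)
    {TI : ∀ (P : NFPoint) (l : ℕ), Cor22.ThetaVolumeDatumAt P l → ThetaIndex}
    (F : ∀ (P : NFPoint) (l : ℕ) (T : Cor22.ThetaVolumeDatumAt P l), LatticeSituation (TI P l T))
    (Q : ∀ (P : NFPoint) (l : ℕ) (T : Cor22.ThetaVolumeDatumAt P l), D4.LinkKummerData (F P l T))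
    (P312 : ∀ (P : NFPoint) (l : ℕ) (T : Cor22.ThetaVolumeDatumAt P l), Cor312.Setting (F P l T).toSituation)
    (ρ : ∀ (P : NFPoint) (l : ℕ) (T : Cor22.ThetaVolumeDatumAt P l),
      (∀ v : (TI P l T).V, v ∈ (TI P l T).Vbad → Set ((F P l T).L.StarPacket v)) →
        ∀ (j : (TI P l T).Label) (vQ : (TI P l T).VQ), Set ((F P l T).L.Packet j vQ))
    (m₁ : ∀ (P : NFPoint) (l : ℕ), Cor22.ThetaVolumeDatumAt P l → ℤ)
    -- [CHAR] team D4's maximally-charitable Theorem 3.11 at every datum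
    (hChar : ∀ P l T, Summit.ABC.IUTFork.Charitable.Thm311Charitable_4 (F P l T) (Q P l T))
    -- [PIN] the Corollary's two region pins for the q-datum `qΨ n m₁`, and the bridge hypotheses
    (hPin : ∀ P l T, Cor312Vol.PinnedRegions (F P l T) (P312 P l T) (ρ P l T) ((Q P l T).qΨ (P312 P l T).n (m₁ P l T)))
    (hBridge : ∀ P l T, Cor312Vol.BridgeHyps (P312 P l T))
    -- [FACT] (none)
    -- [CONE] (ii′) the hull-volume estimate at the genuine data (campaign S); (ii)(b) is inside [CHAR]
    (hvol : ∀ P : NFPoint, P ∈ UP → ∀ l : ℕ, l.Prime → 5 ≤ l →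
      Cor22.AdmitsCore P → Cor22.CondP2 P l → Cor22.CondP5 P l → Cor22.CondP6 P l →
        Cor22.HullVolumeAtDatum P l (((l : ℝ) + 1) / 4 *
          ((1 + 12 * (Cor22.dmod P : ℝ) / l) * (P.logDiff + Cor22.logCondAvoid P {2, l})
            + 2 * Real.log l + 52
            + 20 / 3 * Real.log (((2 ^ 12 * 3 ^ 3 * 5 * Cor22.dmod P : ℕ) : ℝ) * (l : ℝ))
              * (Nat.primeCounting (2 ^ 12 * 3 ^ 3 * 5 * Cor22.dmod P * l) : ℝ))))
    -- [READ] the setting's two numbers are the datum's defined numbers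
    (hΘ : ∀ P l T (x : ℝ), (P312 P l T).negLogTheta = (x : WithTop ℝ) → T.negLogTheta = x)
    (hq : ∀ P l T, (P312 P l T).negLogQ = T.negAbsLogQ) :
    _root_.ABC :=
  Conditional.abc_of_S_v2 F P312 ρ (fun P l T => (Q P l T).qΨ (P312 P l T).n (m₁ P l T))
    (fun P l T => s_of_charitable_4_pinFree (F P l T) (Q P l T) (P312 P l T) (ρ P l T) (m₁ P l T) (hChar P l T))
    hPin hBridge (fun P l T => ((hChar P l T).2.1 (P312 P l T).n).2.1) hvol hΘ hq

end Summit.ABC.IUTFork.Charitable.D4Derive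

end
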